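import Summits.Ventures.CertifiedManyBodySolver.Upper.StripCellDualSectors
import HarnessLib

/-!
# Route `R2cOpenStripTangentLine`, writer (ii) add-on 2/4 (route pen sr-mbsolver-var-7): STRUCTURE OF THE STRIP'S BOND MATRIX (producer-free)

HONEST FRAMING: first certified bounds; not a superconductivity verdict; every number certified or labelled float.
NO NUMBER IS CLAIMED HERE. No certificate `≤ −18/25` per site at density `7/8` exists today — the route's cruxes stay OPEN.

`cellCharge κ S`; every intra-cell term and every inter-cell half-word shifts the cell charge by a definite amount (`cellShift_*`,
`interCellMatrix_conservesCharge`), hence **`stripCellBondMatrix_conservesCharge`** (the two-cell charge is conserved by `hh`); and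
**`stripCellBondMatrix_isHermitian`**. Sources: Essler et al. (2005) §12.3.4 (Jordan–Wigner words); LeBlanc et al., PRX 5 (2015)
041041, eq. (1) [LeBlancEtAl2015].
-/

noncomputable section

open Matrix Finset
open scoped ComplexOrder BigOperators Kronecker

namespace Summit.Ventures.CertifiedManyBodySolver.Upper

open Literature.MathematicalPhysics.QuantumLattice
open Literature.MathematicalPhysics.QuantumLattice.JordanWigner
open Literature.LinearAlgebra.Matrix.PolarOrthonormalization
open Summit.Ventures.CertifiedManyBodySolver.Theorems

/-! ### Part C — cell charge and the structure of the strip's bond matrix -/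

section Structure

variable {c W Q D : ℕ}

/-- **The cell charge**: the total occupation `Σ_f siteCharge` of the cell configuration `κ.symm S` behind
the super-site state `S`. -/
def cellCharge (κ : TensorIndex (Fin c ×ₗ Fin W) 4 ≃ Fin Q) (S : Fin Q) : ℕ :=
  ∑ f, siteCharge ((κ.symm S) f)

/-! ### Structure of the strip's cell bond matrix (producer-free): charge conservation and Hermiticity

Conventions (no `Prop`-valued definitions, by the tree audit): a one-site matrix `M` SHIFTS THE SITE CHARGE
BY `δ` when `∀ a b, M a b ≠ 0 → |a| = |b| + δ`; a one-cell matrix shifts the CELL charge `cellCharge κ` likewise;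
a two-cell matrix `X` CONSERVES the cell charge when `X p p' ≠ 0 → |p.1| + |p.2| = |p'.1| + |p'.2|`. -/

/-- A diagonal one-site matrix conserves the site charge (shift `0`). -/
theorem siteShift_diagonal (d : Fin 4 → ℂ) :
    ∀ a b : Fin 4, diagonal d a b ≠ 0 → (siteCharge a : ℤ) = siteCharge b + 0 := by
  intro a b h
  by_cases hab : a = b
  · subst hab
    simp
  · exact absurd (diagonal_apply_ne d hab) h

/-- The identity one-site matrix conserves the site charge (shift `0`). -/
theorem siteShift_one :
    ∀ a b : Fin 4, (1 : Matrix (Fin 4) (Fin 4) ℂ) a b ≠ 0 → (siteCharge a : ℤ) = siteCharge b + 0 := by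
  rw [← diagonal_one]
  exact siteShift_diagonal _

/-- The site parity `F` conserves the site charge (shift `0`). -/
theorem siteShift_siteParity :
    ∀ a b : Fin 4, siteParity a b ≠ 0 → (siteCharge a : ℤ) = siteCharge b + 0 :=
  siteShift_diagonal _

/-- `c_σ` lowers the site charge by one. -/
theorem siteShift_siteAnnihilation (σ : Fin 2) :
    ∀ a b : Fin 4, siteAnnihilation σ a b ≠ 0 → (siteCharge a : ℤ) = siteCharge b + (-1) := by
  intro a b h
  rw [siteAnnihilation_apply] at h
  by_cases hc : σ ∉ siteOcc a ∧ siteOcc b = insert σ (siteOcc a)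
  · have hcard : siteCharge b = siteCharge a + 1 := by
      unfold siteCharge
      rw [hc.2, Finset.card_insert_of_notMem hc.1]
    omega
  · rw [if_neg hc] at h
    exact absurd rfl h

/-- The conjugate transpose of a one-site matrix of charge shift `δ` has charge shift `-δ`. -/
theorem siteShift_conjTranspose {M : Matrix (Fin 4) (Fin 4) ℂ} {δ : ℤ}
    (hM : ∀ a b : Fin 4, M a b ≠ 0 → (siteCharge a : ℤ) = siteCharge b + δ) :
    ∀ a b : Fin 4, Mᴴ a b ≠ 0 → (siteCharge a : ℤ) = siteCharge b + (-δ) := by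
  intro a b h
  rw [conjTranspose_apply] at h
  have := hM b a fun e => h (by rw [e, star_zero])
  omega

/-- `c†_σ` raises the site charge by one. -/
theorem siteShift_siteCreation (σ : Fin 2) :
    ∀ a b : Fin 4, siteCreation σ a b ≠ 0 → (siteCharge a : ℤ) = siteCharge b + 1 := by
  have h := siteShift_conjTranspose (siteShift_siteAnnihilation σ)
  rw [neg_neg] at h
  exact h

/-- Charge shifts add under multiplication of one-site matrices. -/
theorem siteShift_mul {M N : Matrix (Fin 4) (Fin 4) ℂ} {δ δ' : ℤ}
    (hM : ∀ a b : Fin 4, M a b ≠ 0 → (siteCharge a : ℤ) = siteCharge b + δ)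
    (hN : ∀ a b : Fin 4, N a b ≠ 0 → (siteCharge a : ℤ) = siteCharge b + δ') :
    ∀ a b : Fin 4, (M * N) a b ≠ 0 → (siteCharge a : ℤ) = siteCharge b + (δ + δ') := by
  intro a b h
  rw [Matrix.mul_apply] at h
  obtain ⟨m, -, hm⟩ := Finset.exists_ne_zero_of_sum_ne_zero h
  have h1 := hM a m (left_ne_zero_of_mul hm)
  have h2 := hN m b (right_ne_zero_of_mul hm)
  omega

/-- A word that shifts the charge by `δ` at one site `f₀` and preserves it elsewhere shifts the total
charge of a configuration by `δ`. -/
theorem sum_siteCharge_eq_of_productOp_apply_ne_zero {F : Type*} [Fintype F] [DecidableEq F]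
    (g : F → Matrix (Fin 4) (Fin 4) ℂ) (f₀ : F) {δ : ℤ}
    (h0 : ∀ a b : Fin 4, g f₀ a b ≠ 0 → (siteCharge a : ℤ) = siteCharge b + δ)
    (hg : ∀ f, f ≠ f₀ → ∀ a b : Fin 4, g f a b ≠ 0 → (siteCharge a : ℤ) = siteCharge b + 0)
    (σ τ : F → Fin 4) (h : productOp g σ τ ≠ 0) :
    (∑ f, (siteCharge (σ f) : ℤ)) = (∑ f, (siteCharge (τ f) : ℤ)) + δ := by
  rw [productOp_apply] at h
  have hf : ∀ f, g f (σ f) (τ f) ≠ 0 := fun f => Finset.prod_ne_zero_iff.1 h f (Finset.mem_univ f)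
  have key : ∀ f, (siteCharge (σ f) : ℤ) = siteCharge (τ f) + if f = f₀ then δ else 0 := by
    intro f
    by_cases hff : f = f₀
    · rw [if_pos hff, hff]
      exact h0 _ _ (hf f₀)
    · rw [if_neg hff]
      exact hg f hff _ _ (hf f)
  rw [Finset.sum_congr rfl fun f _ => key f, Finset.sum_add_distrib,
    Finset.sum_ite_eq' Finset.univ f₀, if_pos (Finset.mem_univ _)]

/-- The LEFT inter-cell word is `M` at the site `(c − 1, y₀)` … -/
theorem interLeftFamily_self (hc : 0 < c) (y₀ : Fin W) (M : Matrix (Fin 4) (Fin 4) ℂ) :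
    interLeftFamily hc y₀ M (toLex (⟨c - 1, by omega⟩, y₀)) = M := by
  unfold interLeftFamily
  simp

/-- … and `siteParity` or `1` elsewhere. -/
theorem interLeftFamily_of_ne (hc : 0 < c) (y₀ : Fin W) (M : Matrix (Fin 4) (Fin 4) ℂ)
    {f : Fin c ×ₗ Fin W} (hf : f ≠ toLex (⟨c - 1, by omega⟩, y₀)) :
    interLeftFamily hc y₀ M f = siteParity ∨ interLeftFamily hc y₀ M f = 1 := by
  unfold interLeftFamily
  split_ifs with h1 h2 h3
  · exact absurd (by rw [← h1, ← h2]; rfl) hf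
  · exact Or.inl rfl
  · exact Or.inr rfl
  · exact Or.inr rfl

/-- The RIGHT inter-cell word is `M` at the site `(0, y₀)` … -/
theorem interRightFamily_self (hc : 0 < c) (y₀ : Fin W) (M : Matrix (Fin 4) (Fin 4) ℂ) :
    interRightFamily hc y₀ M (toLex (⟨0, hc⟩, y₀)) = M := by
  unfold interRightFamily
  simp

/-- … and `siteParity` or `1` elsewhere. -/
theorem interRightFamily_of_ne (hc : 0 < c) (y₀ : Fin W) (M : Matrix (Fin 4) (Fin 4) ℂ)
    {f : Fin c ×ₗ Fin W} (hf : f ≠ toLex (⟨0, hc⟩, y₀)) :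
    interRightFamily hc y₀ M f = siteParity ∨ interRightFamily hc y₀ M f = 1 := by
  unfold interRightFamily
  split_ifs with h1 h2 h3
  · exact absurd (by rw [← h1, ← h2]; rfl) hf
  · exact Or.inl rfl
  · exact Or.inr rfl
  · exact Or.inr rfl

/-- A string factor (`F` or `1`) conserves the site charge. -/
theorem siteShift_of_eq_siteParity_or_one {N : Matrix (Fin 4) (Fin 4) ℂ} (h : N = siteParity ∨ N = 1) :
    ∀ a b : Fin 4, N a b ≠ 0 → (siteCharge a : ℤ) = siteCharge b + 0 := by
  rcases h with h | h <;> rw [h]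
  · exact siteShift_siteParity
  · exact siteShift_one

/-- The cell charge as an integer sum of site charges. -/
theorem cellCharge_cast (κ : TensorIndex (Fin c ×ₗ Fin W) 4 ≃ Fin Q) (S : Fin Q) :
    (cellCharge κ S : ℤ) = ∑ f, (siteCharge ((κ.symm S) f) : ℤ) := by
  simp [cellCharge]

/-- Blocking a word: the cell-charge shift of `superSite κ (⨂ g)` is the shift of its one active site. -/
theorem cellShift_superSite_productOp (κ : TensorIndex (Fin c ×ₗ Fin W) 4 ≃ Fin Q)
    (g : (Fin c ×ₗ Fin W) → Matrix (Fin 4) (Fin 4) ℂ) (f₀ : Fin c ×ₗ Fin W) {δ : ℤ}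
    (h0 : ∀ a b : Fin 4, g f₀ a b ≠ 0 → (siteCharge a : ℤ) = siteCharge b + δ)
    (hg : ∀ f, f ≠ f₀ → ∀ a b : Fin 4, g f a b ≠ 0 → (siteCharge a : ℤ) = siteCharge b + 0) :
    ∀ S S' : Fin Q, superSite κ (productOp g) S S' ≠ 0 →
      (cellCharge κ S : ℤ) = cellCharge κ S' + δ := by
  intro S S' h
  rw [superSite_apply] at h
  rw [cellCharge_cast, cellCharge_cast]
  exact sum_siteCharge_eq_of_productOp_apply_ne_zero g f₀ h0 hg _ _ h

/-- The identity super-site matrix conserves the cell charge. -/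
theorem cellShift_one (κ : TensorIndex (Fin c ×ₗ Fin W) 4 ≃ Fin Q) :
    ∀ S S' : Fin Q, (1 : Matrix (Fin Q) (Fin Q) ℂ) S S' ≠ 0 →
      (cellCharge κ S : ℤ) = cellCharge κ S' + 0 := by
  intro S S' h
  by_cases hS : S = S'
  · subst hS
    simp
  · exact absurd (one_apply_ne hS) h

/-- **The intra-cell Hamiltonian conserves the cell charge** (`[H, N] = 0`, transported through `toSpin`
and the blocking `superSite κ`). -/
theorem cellShift_superSite_toSpin_hubbardOpenBoxTT' (κ : TensorIndex (Fin c ×ₗ Fin W) 4 ≃ Fin Q)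
    (t t' U : ℝ) :
    ∀ S S' : Fin Q, superSite κ (JordanWigner.toSpin (hubbardOpenBoxTT' c W t t' U)) S S' ≠ 0 →
      (cellCharge κ S : ℤ) = cellCharge κ S' + 0 := by
  have h := ((hubbardOpenBoxTT'_commute_totalNumber c W t t' U).map
    (JordanWigner.toSpin (Λ := Fin c ×ₗ Fin W))).map (superSite κ)
  rw [toSpin_totalNumber, superSite_sum_onSite_siteTotalNumber κ] at h
  intro S S' hM
  rw [add_zero]
  by_contra hne
  exact hM (apply_eq_zero_of_commute_labelOp (fun S => (cellCharge κ S : ℤ)) h.symm hne)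

/-- Kronecker product of a left word shifting by `a` and a right word shifting by `b = −a` conserves the
two-cell charge. -/
theorem conservesCharge_kronecker (κ : TensorIndex (Fin c ×ₗ Fin W) 4 ≃ Fin Q)
    {L R : Matrix (Fin Q) (Fin Q) ℂ} {a b : ℤ}
    (hL : ∀ S S' : Fin Q, L S S' ≠ 0 → (cellCharge κ S : ℤ) = cellCharge κ S' + a)
    (hR : ∀ S S' : Fin Q, R S S' ≠ 0 → (cellCharge κ S : ℤ) = cellCharge κ S' + b) (hab : a + b = 0) :
    ∀ p p', (L ⊗ₖ R) p p' ≠ 0 →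
      (cellCharge κ p.1 : ℤ) + cellCharge κ p.2 = cellCharge κ p'.1 + cellCharge κ p'.2 := by
  rintro ⟨S, T⟩ ⟨S', T'⟩ h
  rw [Matrix.kronecker_apply] at h
  have h1 := hL S S' (left_ne_zero_of_mul h)
  have h2 := hR T T' (right_ne_zero_of_mul h)
  simp only
  omega

/-- Charge conservation of two-cell matrices is stable under addition. -/
theorem conservesCharge_add (κ : TensorIndex (Fin c ×ₗ Fin W) 4 ≃ Fin Q)
    {X Y : Matrix (Fin Q × Fin Q) (Fin Q × Fin Q) ℂ}
    (hX : ∀ p p', X p p' ≠ 0 →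
      (cellCharge κ p.1 : ℤ) + cellCharge κ p.2 = cellCharge κ p'.1 + cellCharge κ p'.2)
    (hY : ∀ p p', Y p p' ≠ 0 →
      (cellCharge κ p.1 : ℤ) + cellCharge κ p.2 = cellCharge κ p'.1 + cellCharge κ p'.2) :
    ∀ p p', (X + Y) p p' ≠ 0 →
      (cellCharge κ p.1 : ℤ) + cellCharge κ p.2 = cellCharge κ p'.1 + cellCharge κ p'.2 := by
  intro p p' h
  rw [Matrix.add_apply] at h
  by_cases hx : X p p' = 0
  · rw [hx, zero_add] at h
    exact hY p p' h
  · exact hX p p' hx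

/-- Charge conservation of two-cell matrices is stable under scalar multiplication. -/
theorem conservesCharge_smul (κ : TensorIndex (Fin c ×ₗ Fin W) 4 ≃ Fin Q)
    {X : Matrix (Fin Q × Fin Q) (Fin Q × Fin Q) ℂ}
    (hX : ∀ p p', X p p' ≠ 0 →
      (cellCharge κ p.1 : ℤ) + cellCharge κ p.2 = cellCharge κ p'.1 + cellCharge κ p'.2) (a : ℂ) :
    ∀ p p', (a • X) p p' ≠ 0 →
      (cellCharge κ p.1 : ℤ) + cellCharge κ p.2 = cellCharge κ p'.1 + cellCharge κ p'.2 := by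
  intro p p' h
  rw [Matrix.smul_apply, smul_eq_mul] at h
  exact hX p p' (right_ne_zero_of_mul h)

/-- Charge conservation of two-cell matrices is stable under finite sums. -/
theorem conservesCharge_sum (κ : TensorIndex (Fin c ×ₗ Fin W) 4 ≃ Fin Q) {ι : Type*} (s : Finset ι)
    {X : ι → Matrix (Fin Q × Fin Q) (Fin Q × Fin Q) ℂ}
    (hX : ∀ i ∈ s, ∀ p p', X i p p' ≠ 0 →
      (cellCharge κ p.1 : ℤ) + cellCharge κ p.2 = cellCharge κ p'.1 + cellCharge κ p'.2) :
    ∀ p p', (∑ i ∈ s, X i) p p' ≠ 0 →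
      (cellCharge κ p.1 : ℤ) + cellCharge κ p.2 = cellCharge κ p'.1 + cellCharge κ p'.2 := by
  intro p p' h
  rw [Matrix.sum_apply] at h
  obtain ⟨i, hi, hne⟩ := Finset.exists_ne_zero_of_sum_ne_zero h
  exact hX i hi p p' hne

/-- **The inter-cell coupling conserves the cell charge**: each word moves one fermion across the cut. -/
theorem interCellMatrix_conservesCharge (κ : TensorIndex (Fin c ×ₗ Fin W) 4 ≃ Fin Q) (hc : 0 < c)
    (t : ℝ) :
    ∀ p p', interCellMatrix κ hc t p p' ≠ 0 →
      (cellCharge κ p.1 : ℤ) + cellCharge κ p.2 = cellCharge κ p'.1 + cellCharge κ p'.2 := by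
  unfold interCellMatrix
  refine conservesCharge_smul κ (conservesCharge_sum κ _ fun y₀ _ =>
    conservesCharge_sum κ _ fun σ _ => ?_) _
  refine conservesCharge_add κ ?_ ?_
  · refine conservesCharge_kronecker κ (a := 1 + 0) (b := -1)
      (cellShift_superSite_productOp κ _ (toLex (⟨c - 1, by omega⟩, y₀))
        (by rw [interLeftFamily_self]
            exact siteShift_mul (siteShift_siteCreation σ) siteShift_siteParity)
        fun f hf => siteShift_of_eq_siteParity_or_one (interLeftFamily_of_ne hc y₀ _ hf))
      (cellShift_superSite_productOp κ _ (toLex (⟨0, hc⟩, y₀))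
        (by rw [interRightFamily_self]; exact siteShift_siteAnnihilation σ)
        fun f hf => siteShift_of_eq_siteParity_or_one (interRightFamily_of_ne hc y₀ _ hf)) (by norm_num)
  · refine conservesCharge_kronecker κ (a := 0 + -1) (b := 1)
      (cellShift_superSite_productOp κ _ (toLex (⟨c - 1, by omega⟩, y₀))
        (by rw [interLeftFamily_self]
            exact siteShift_mul siteShift_siteParity (siteShift_siteAnnihilation σ))
        fun f hf => siteShift_of_eq_siteParity_or_one (interLeftFamily_of_ne hc y₀ _ hf))
      (cellShift_superSite_productOp κ _ (toLex (⟨0, hc⟩, y₀))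
        (by rw [interRightFamily_self]; exact siteShift_siteCreation σ)
        fun f hf => siteShift_of_eq_siteParity_or_one (interRightFamily_of_ne hc y₀ _ hf)) (by norm_num)

/-- **The strip's cell bond matrix conserves the cell charge** (the structural hypothesis `hXc` of the
per-sector entry point, discharged). -/
theorem stripCellBondMatrix_conservesCharge (κ : TensorIndex (Fin c ×ₗ Fin W) 4 ≃ Fin Q) (hc : 0 < c)
    (t U : ℝ) :
    ∀ p p', stripCellBondMatrix κ hc t U p p' ≠ 0 →
      (cellCharge κ p.1 : ℤ) + cellCharge κ p.2 = cellCharge κ p'.1 + cellCharge κ p'.2 := by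
  unfold stripCellBondMatrix
  exact conservesCharge_add κ (conservesCharge_kronecker κ
    (cellShift_superSite_toSpin_hubbardOpenBoxTT' κ t 0 U) (cellShift_one κ) (by norm_num))
    (interCellMatrix_conservesCharge κ hc t)

/-- Conjugate transpose of the left inter-cell half-word, factor by factor. -/
theorem interLeftFamily_conjTranspose (hc : 0 < c) (y₀ : Fin W) (M : Matrix (Fin 4) (Fin 4) ℂ) :
    (fun f => (interLeftFamily hc y₀ M f)ᴴ) = interLeftFamily hc y₀ Mᴴ := by
  funext f
  unfold interLeftFamily
  split_ifs <;> simp [siteParity_conjTranspose]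

/-- Conjugate transpose of the right inter-cell half-word, factor by factor. -/
theorem interRightFamily_conjTranspose (hc : 0 < c) (y₀ : Fin W) (M : Matrix (Fin 4) (Fin 4) ℂ) :
    (fun f => (interRightFamily hc y₀ M f)ᴴ) = interRightFamily hc y₀ Mᴴ := by
  funext f
  unfold interRightFamily
  split_ifs <;> simp [siteParity_conjTranspose]

/-- `superSite` of a product operator commutes with the conjugate transpose, factor by factor. -/
theorem superSite_productOp_conjTranspose {F : Type*} [Fintype F] [DecidableEq F]
    (κ : TensorIndex F 4 ≃ Fin Q) (g : F → Matrix (Fin 4) (Fin 4) ℂ) :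
    (superSite κ (productOp g))ᴴ = superSite κ (productOp fun f => (g f)ᴴ) := by
  rw [← superSite_conjTranspose, productOp_conjTranspose]

/-- `(c†_σ F)ᴴ = F c_σ`. -/
theorem conjTranspose_siteCreation_mul_siteParity (σ : Fin 2) :
    (siteCreation σ * siteParity)ᴴ = siteParity * siteAnnihilation σ := by
  rw [conjTranspose_mul, siteParity_conjTranspose, siteCreation, conjTranspose_conjTranspose]

/-- `(F c_σ)ᴴ = c†_σ F`. -/
theorem conjTranspose_siteParity_mul_siteAnnihilation (σ : Fin 2) :
    (siteParity * siteAnnihilation σ)ᴴ = siteCreation σ * siteParity := by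
  rw [conjTranspose_mul, siteParity_conjTranspose, siteCreation]

/-- `(c_σ)ᴴ = c†_σ` (definitional). -/
theorem conjTranspose_siteAnnihilation (σ : Fin 2) : (siteAnnihilation σ)ᴴ = siteCreation σ := rfl

/-- `(c†_σ)ᴴ = c_σ`. -/
theorem conjTranspose_siteCreation (σ : Fin 2) : (siteCreation σ)ᴴ = siteAnnihilation σ := by
  rw [siteCreation, conjTranspose_conjTranspose]

/-- **The inter-cell coupling is Hermitian** (the two words of each bond are each other's adjoints). -/
theorem interCellMatrix_isHermitian (κ : TensorIndex (Fin c ×ₗ Fin W) 4 ≃ Fin Q) (hc : 0 < c) (t : ℝ) :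
    (interCellMatrix κ hc t).IsHermitian := by
  have hterm : ∀ (y₀ : Fin W) (σ : Fin 2),
      (superSite κ (productOp (interLeftFamily hc y₀ (siteCreation σ * siteParity))) ⊗ₖ
          superSite κ (productOp (interRightFamily hc y₀ (siteAnnihilation σ))) +
        superSite κ (productOp (interLeftFamily hc y₀ (siteParity * siteAnnihilation σ))) ⊗ₖ
          superSite κ (productOp (interRightFamily hc y₀ (siteCreation σ))))ᴴ =
      superSite κ (productOp (interLeftFamily hc y₀ (siteCreation σ * siteParity))) ⊗ₖ
          superSite κ (productOp (interRightFamily hc y₀ (siteAnnihilation σ))) +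
        superSite κ (productOp (interLeftFamily hc y₀ (siteParity * siteAnnihilation σ))) ⊗ₖ
          superSite κ (productOp (interRightFamily hc y₀ (siteCreation σ))) := by
    intro y₀ σ
    rw [conjTranspose_add, conjTranspose_kronecker, conjTranspose_kronecker,
      superSite_productOp_conjTranspose, superSite_productOp_conjTranspose,
      superSite_productOp_conjTranspose, superSite_productOp_conjTranspose,
      interLeftFamily_conjTranspose, interLeftFamily_conjTranspose, interRightFamily_conjTranspose,
      interRightFamily_conjTranspose, conjTranspose_siteCreation_mul_siteParity,
      conjTranspose_siteAnnihilation, conjTranspose_siteParity_mul_siteAnnihilation,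
      conjTranspose_siteCreation, add_comm]
  unfold interCellMatrix Matrix.IsHermitian
  rw [conjTranspose_smul, conjTranspose_sum]
  simp_rw [conjTranspose_sum, hterm]
  congr 1
  rw [star_neg, Complex.star_def, Complex.conj_ofReal]

/-- **The strip's cell bond matrix is Hermitian** (the hypothesis `hXh` of the entry points, discharged). -/
theorem stripCellBondMatrix_isHermitian (κ : TensorIndex (Fin c ×ₗ Fin W) 4 ≃ Fin Q) (hc : 0 < c)
    (t U : ℝ) : (stripCellBondMatrix κ hc t U).IsHermitian := by
  have hA : (superSite κ (JordanWigner.toSpin (hubbardOpenBoxTT' c W t 0 U))).IsHermitian := by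
    rw [Matrix.IsHermitian, ← superSite_conjTranspose, ← toSpin_conjTranspose,
      (hubbardOpenBoxTT'_isHermitian c W t 0 U).eq]
  have h1 : (superSite κ (JordanWigner.toSpin (hubbardOpenBoxTT' c W t 0 U)) ⊗ₖ
      (1 : Matrix (Fin Q) (Fin Q) ℂ)).IsHermitian := by
    rw [Matrix.IsHermitian, conjTranspose_kronecker, conjTranspose_one, hA.eq]
  unfold stripCellBondMatrix
  exact h1.add (interCellMatrix_isHermitian κ hc t)

end Structure

end Summit.Ventures.CertifiedManyBodySolver.Upper

end
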